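import Literature.AlgebraicGeometry.AbelianSchemes.LevelStructureSymplecticClassLocusClopen
import Literature.AlgebraicGeometry.AbelianSchemes.SymplecticRefinementPoint
import Literature.AlgebraicGeometry.AbelianSchemes.LevelStructureTwistLocallyConstant
import Literature.AlgebraicGeometry.AbelianSchemes.SectionEqualityLocus
import HarnessLib

/-!
# The symplectic refinement cover: a symplectic-liftable level-`N` structure refines to a symplectic-liftable
# level-`NK` structure over a finite étale surjective cover of the base
# ([MumfordFogartyKirwan1994] Ch. 7 §3 / App. 7A: `𝒜_{g,δ,nm} → 𝒜_{g,δ,n}` finite étale surjective)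

Layer `Literature/AlgebraicGeometry/AbelianSchemes`, namespace `Literature.AlgebraicGeometry.AbelianSchemes.AbelianSchemeOver`.
THEOREMS ONLY (no definition, no named fact, no instance, no notation, no `sorry`; every object inside an `∃`).  Cell
`hodgecm-mathlib` (D-0151), F-DAG F-10 (b) «classify for `M/Γ`», STEP (b4) «THE COVER» — the HEAD (author B-p02 (g13);
B-p06 (g11)'s census `F10b-CENSUS-SKELETON` §road 1, consumer (b2)).  Count-neutral capital; HC_CM is proved only modulo the
7 printed citations until rung 0 closes — nothing here is about HC.

The statement ([MumfordFogartyKirwan1994] Ch. 7 §3 p. 139 / App. 7A p. 235: the forgetful morphisms between the moduli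
schemes of different levels are finite, étale and surjective; [Lan2013PELCompactifications] Rem. 1.4.1.9: passage between
levels by finite étale covers).  Let `T` be locally Noetherian with every positive integer invertible in its residue fields
(a `ℚ`-scheme), `A/T` an abelian scheme of relative dimension `g` with a polarisation `λ` and a level-`N` structure `ψ`,
SYMPLECTIC-LIFTABLE of type `δ`, and `K ≥ 1`.  Then there are a finite étale `b : B → T` with a level-`NK` structure `Φ` on
`A ×_T B` and an OPEN AND CLOSED `W ⊆ B` such that `W → T` is (finite étale and) SURJECTIVE, and over `W`: `Φ` REFINES `ψ`
(`(Φ|_W).changeLevel N K = ψ|_W`) and `Φ|_W` is SYMPLECTIC-LIFTABLE of type `δ` for `λ|_W`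
(`exists_finite_etale_surjective_symplecticRefinement`, iterated-base-change form `(A ×_T B) ×_B W`).

Assembly (all inputs ★): the cover of level-`NK` bases WITH VALUES (★ `LevelBasisFiniteEtaleCoverValues`); the refinement
locus `E = ⋂ᵢ {Φᵢ^K = ψᵢ}` — open and closed with its test-morphism characterisation (★ `LevelStructureTwistLocallyConstant`
`exists_isClopen_comp_left_eq_iff`); the symplectic-liftable locus `U` of `Φ` — open and closed over the (non-reduced!) cover
(★ `LevelStructureSymplecticClassLocusClopen` `isClopen_setOf_liftAt`, resting on the (h9-S) W3c head
★ `isSymplecticLiftable_of_nonempty_symplecticLift_of_isLocallyNoetherian`); `W := E ∩ U`; `Φ|_W` liftable by ★ FILE A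
`isSymplecticLiftable_baseChange_ι_iff`; refinement over `W` by ★ `sectionBaseChange_eq_iff_comp_left_eq`; SURJECTIVITY by
the pointwise step ★ `SymplecticRefinementPoint` (over each geometric point `s̄`, the level-`NK` stage of a lift of `ψ(s̄)`
is realised by a point `t ∈ E` carrying a lift of `Φ`, hence `t ∈ U` by ★ `liftAt_of_nonempty_symplecticLift`).

## References
* [MumfordFogartyKirwan1994] D. Mumford, J. Fogarty, F. Kirwan, *Geometric Invariant Theory*, 3rd ed. (1994), Ch. 7 §2
  Definition 7.1, 7.2 (p. 129), Ch. 7 §3 (p. 139, Lemma 7.11 p. 140), App. 7A (p. 235).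
* [Lan2013PELCompactifications] K.-W. Lan, *Arithmetic compactifications of PEL-type Shimura varieties* (2013), §1.3.6
  Lemma 1.3.6.6 and Cor. 1.3.6.7 (pp. 81–82), §1.4.1 Rem. 1.4.1.9.
-/

noncomputable section

universe u

open CategoryTheory CategoryTheory.Limits AlgebraicGeometry

namespace Literature.AlgebraicGeometry.AbelianSchemes

namespace AbelianSchemeOver

open Literature.AlgebraicGeometry.Motives Literature.AlgebraicGeometry.Morphisms
open scoped MonObj

variable {T : Scheme.{u}} (A : AbelianSchemeOver T) {D : A.DualPair} (pol : A.Polarization D) {g N : ℕ}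
  (ψ : A.LevelStructure g N) (δ : Fin g → ℕ)

/-- **THE SYMPLECTIC REFINEMENT COVER** ([MumfordFogartyKirwan1994] Ch. 7 §3 / App. 7A: `𝒜_{g,δ,nm} → 𝒜_{g,δ,n}` is finite,
étale and surjective; [Lan2013PELCompactifications] Rem. 1.4.1.9).  `T` locally Noetherian with every positive integer
invertible in its residue fields, `A/T` of relative dimension `g`, `λ` a polarisation, `ψ` a level-`N` structure
symplectic-liftable of type `δ`, `N, K ≠ 0`.  There are a finite étale `b : B → T`, a level-`NK` structure `Φ` on `A ×_T B`
and an open-and-closed `W ⊆ B` with `W ↪ B → T` finite étale SURJECTIVE, such that over `W` the structure `Φ` refines `ψ`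
(`(Φ ×_B W).changeLevel N K = (ψ ×_T B) ×_B W`) and is symplectic-liftable of type `δ` for `(λ ×_T B) ×_B W`.
[cite: MumfordFogartyKirwan1994, Ch. 7 §3 (p. 139) and App. 7A (p. 235)]
[cite: Lan2013PELCompactifications, §1.3.6 Lemma 1.3.6.6 and Cor. 1.3.6.7 (pp. 81–82)] -/
theorem LevelStructure.exists_finite_etale_surjective_symplecticRefinement [IsLocallyNoetherian T]
    (hg : A.IsOfRelDim g) (hQ : ∀ M : ℕ, M ≠ 0 → ∀ t : T, (M : T.residueField t) ≠ 0)
    (hψ : ψ.IsSymplecticLiftable pol δ) (hN : N ≠ 0) {K : ℕ} (hK : K ≠ 0) :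
    ∃ (B : Scheme.{u}) (b : B ⟶ T) (Φ : (A.baseChange b).LevelStructure g (N * K)) (W : B.Opens),
      IsFinite b ∧ Etale b ∧ IsClopen (W : Set B) ∧ IsFinite W.ι ∧ Etale W.ι ∧ Surjective (W.ι ≫ b) ∧
      (Φ.baseChange W.ι).changeLevel N K rfl (Nat.mul_ne_zero hN hK) = (ψ.baseChange b).baseChange W.ι ∧
      (Φ.baseChange W.ι).IsSymplecticLiftable ((pol.baseChange b).baseChange W.ι) δ := by
  classical
  have hM0 : N * K ≠ 0 := Nat.mul_ne_zero hN hK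
  haveI : NeZero (N * K) := ⟨hM0⟩
  haveI : NeZero N := ⟨hN⟩
  haveI : IsCommMonObj A.X := A.isCommMonObj_of_isLocallyNoetherian_base
  -- (1) the cover of level-`NK` bases with values
  obtain ⟨B, b, Φ, hfin, het, -, hreal⟩ :=
    A.exists_finite_etale_surjective_levelStructure_restrict_eq (M := N * K) hg (hQ (N * K) hM0)
  haveI := hfin
  haveI := het
  haveI : IsLocallyNoetherian B := LocallyOfFiniteType.isLocallyNoetherian b
  haveI : IsCommMonObj (A.baseChange b).X := (A.baseChange b).isCommMonObj_of_isLocallyNoetherian_base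
  have hQB : ∀ M : ℕ, M ≠ 0 → ∀ t : B, (M : B.residueField t) ≠ 0 := fun M hM t =>
    natCast_residueField_ne_zero_of_hom b (hQ M hM) t
  -- (2) the refinement locus `E = ⋂ᵢ Eᵢ`, clopen with its test-morphism characterisation
  have hE := fun i => exists_isClopen_comp_left_eq_iff (A := A.baseChange b) (hQB N hN)
    ((Φ.changeLevel N K rfl hM0).σ i) ((ψ.baseChange b).σ i) ((Φ.changeLevel N K rfl hM0).pow_σ i)
    ((ψ.baseChange b).pow_σ i)
  choose E hEclopen hEiff using hE
  -- (3) the symplectic-liftable locus `U` of `Φ`, clopen over the (non-reduced) cover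
  have hU := LevelStructure.isClopen_setOf_liftAt (A.baseChange b) (pol.baseChange b) Φ δ
    (hg.baseChange b) hQB hM0
  -- (4) `W := E ∩ U`
  let Wset : Set B := (⋂ i, E i) ∩ {x : B | ∀ (Ω : Type u) [Field Ω] [IsAlgClosed Ω] (s : Spec (.of Ω) ⟶ B),
      s.base (IsLocalRing.closedPoint Ω) = x →
      ∀ Θ : CartierDivisor ((A.baseChange b).fibre s).toAbelianVariety.X.left, Θ.IsAmple →
        (A.baseChange b).IsLambdaOfAt s (D.baseChange b) (pol.baseChange b).lam Θ → Nonempty (Φ.SymplecticLift s Θ δ)}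
  have hWclopen : IsClopen Wset := (isClopen_iInter_of_finite hEclopen).inter hU
  let W : B.Opens := ⟨Wset, hWclopen.isOpen⟩
  obtain ⟨hfinι, hetι⟩ := isFinite_and_etale_ι_of_isClosed W hWclopen.isClosed
  haveI := hfinι
  haveI := hetι
  refine ⟨B, b, Φ, W, hfin, het, hWclopen, hfinι, hetι, ⟨fun p => ?_⟩, ?_, ?_⟩
  · -- (7) SURJECTIVITY: the pointwise step over the geometric point `Spec κ(p)^alg → T`
    let Ω : Type u := AlgebraicClosure (T.residueField p)
    let s₀ : Spec (.of Ω) ⟶ T :=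
      Spec.map (CommRingCat.ofHom (algebraMap (T.residueField p) Ω)) ≫ T.fromSpecResidueField p
    have hs₀ : s₀.base (IsLocalRing.closedPoint Ω) = p := by
      change (T.fromSpecResidueField p).base _ = p
      exact Scheme.fromSpecResidueField_apply p _
    obtain ⟨Θ, hΘ, hlam⟩ := pol.exists_ample Ω s₀
    obtain ⟨Λ⟩ := hψ Ω s₀ Θ hΘ hlam
    obtain ⟨t, ht, href, Θ', -, hlam', ⟨Λ'⟩⟩ :=
      LevelStructure.exists_point_refining_nonempty_symplecticLift b rfl hM0 Φ hreal pol δ ψ s₀ hΘ hlam Λ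
    -- `t` lands in `E` (refinement) and in `U` (one lift ⇒ liftable locus)
    have htE : ∀ i, t.base (IsLocalRing.closedPoint Ω) ∈ E i := fun i =>
      ((hEiff i t).1 (href i)) ⟨_, rfl⟩
    have htU := LevelStructure.liftAt_of_nonempty_symplecticLift (A.baseChange b)
      (pol.baseChange b) Φ δ (hg.baseChange b) hQB hM0 t rfl hlam' Λ'
    have htW : t.base (IsLocalRing.closedPoint Ω) ∈ Wset := ⟨Set.mem_iInter.2 htE, htU⟩
    obtain ⟨w, hw⟩ : t.base (IsLocalRing.closedPoint Ω) ∈ Set.range W.ι.base := by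
      rw [Scheme.Opens.range_ι]; exact htW
    refine ⟨w, ?_⟩
    rw [Scheme.Hom.comp_apply, hw, ← Scheme.Hom.comp_apply, ht, hs₀]
  · -- (5) refinement over `W`: compare the pulled-back sections through the test morphism `W.ι`
    apply LevelStructure.ext_σ
    funext i
    rw [LevelStructure.changeLevel_σ, LevelStructure.baseChange_σ, LevelStructure.baseChange_σ, ← map_pow,
      ← LevelStructure.changeLevel_σ Φ N K rfl hM0, sectionBaseChange_eq_iff_comp_left_eq]
    refine (hEiff i W.ι).2 ?_
    rw [Scheme.Opens.range_ι]
    exact fun x hx => (Set.mem_iInter.1 hx.1) i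
  · -- (6) symplectic-liftability over `W`
    exact (LevelStructure.isSymplecticLiftable_baseChange_ι_iff (A.baseChange b) (pol.baseChange b) Φ δ W).2
      fun x hx => hx.2

end AbelianSchemeOver

end Literature.AlgebraicGeometry.AbelianSchemes

end
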